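import Mathlib
import HarnessLib

/-!
# The trace-zero adjoint representation `Ad⁰` of a rank-2 matrix representation (model on `k³`)

Helper file for the item `EssSelfDualIrreducibleCM` (stmt-Langlands-13618) of the route
`IrreducibilityBySelfDuality`: pure linear algebra over a field `k`.
-/

noncomputable section

set_option linter.dupNamespace false -- project-wide option (lakefile weak.linter.dupNamespace); `Summit.Langlands.Langlands` is the mandated namespace

open Matrix

namespace Summit.Langlands.Langlands.Theorems.EssSelfDualIrreducibleCM

variable {k : Type*} [Field k] {Γ : Type*} [Group Γ]

/-- The `(0,0)` entry of `P⁻¹ * P = 1` for `P ∈ GL₂(k)`: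
`P'₀₀ P₀₀ + P'₀₁ P₁₀ = 1` with `P' = P⁻¹`. [folklore] -/
theorem gl_two_inv_mul_apply_zero_zero (P : GL (Fin 2) k) :
    ((P⁻¹ : GL (Fin 2) k) : Matrix (Fin 2) (Fin 2) k) 0 0 * (P : Matrix (Fin 2) (Fin 2) k) 0 0 +
      ((P⁻¹ : GL (Fin 2) k) : Matrix (Fin 2) (Fin 2) k) 0 1 * (P : Matrix (Fin 2) (Fin 2) k) 1 0 = 1 := by
  have hPP : ((P⁻¹ : GL (Fin 2) k) : Matrix (Fin 2) (Fin 2) k) * (P : Matrix (Fin 2) (Fin 2) k) = 1 := by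
    rw [← Units.val_mul, inv_mul_cancel, Units.val_one]
  have h00 := congr_fun (congr_fun hPP 0) 0
  simpa only [Matrix.mul_apply, Fin.sum_univ_two, Matrix.one_apply_eq] using h00

/-- **The trace-zero adjoint representation, modelled on `k³`.**  For a homomorphism
`ρ : Γ → GL₂(k)` over a field `k` there are a representation `Ad` of `Γ` on `k³` and an injective
linear map `φ : k³ → M₂(k)` with trace-zero values (`φ(a,b,c) = (a b; c -a)`) such that
`φ(Ad(g) v) = ρ(g) φ(v) ρ(g)⁻¹` — so `Ad` is the conjugation representation `Ad⁰ ρ` on `𝔰𝔩₂ ⊂ 𝔤𝔩₂`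
read in the coordinates `φ` — whose character is `χ_{Ad}(g) = tr ρ(g) · tr ρ(g)⁻¹ - 1`
(`= χ_ρ(g) χ_{ρ^∨}(g) - 1`, the character of `End⁰(ρ)`).  (Construction: `Ad(g) = π₀ ∘ c_g ∘ φ` with
`c_g(T) = ρ(g) T ρ(g)⁻¹` and `π₀(T) = (-T₁₁, T₀₁, T₁₀)`, a left inverse of `φ` on trace-zero
matrices; no assumption on the characteristic is needed.) [folklore] -/
theorem exists_adZero (ρ : Γ →* GL (Fin 2) k) :
    ∃ (Ad : Representation k Γ (Fin 3 → k)) (φ : (Fin 3 → k) →ₗ[k] Matrix (Fin 2) (Fin 2) k),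
      Function.Injective φ ∧ (∀ v, (φ v).trace = 0) ∧
      (∀ g v, φ (Ad g v) = (ρ g : Matrix (Fin 2) (Fin 2) k) * φ v *
        ((ρ g)⁻¹ : GL (Fin 2) k)) ∧
      ∀ g, Ad.character g = (ρ g : Matrix (Fin 2) (Fin 2) k).trace *
        (((ρ g)⁻¹ : GL (Fin 2) k) : Matrix (Fin 2) (Fin 2) k).trace - 1 := by
  -- the model map `φ : k³ → 𝔰𝔩₂` and the projection `π₀ : 𝔤𝔩₂ → k³` along `k E₀₀`
  let φ : (Fin 3 → k) →ₗ[k] Matrix (Fin 2) (Fin 2) k :=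
    { toFun := fun v => Matrix.of ![![v 0, v 1], ![v 2, -v 0]]
      map_add' := fun v w => by
        ext i j; fin_cases i <;> fin_cases j <;> simp [add_comm]
      map_smul' := fun c v => by
        ext i j; fin_cases i <;> fin_cases j <;> simp }
  have hφ : ∀ v, φ v = Matrix.of ![![v 0, v 1], ![v 2, -v 0]] := fun _ => rfl
  let π₀ : Matrix (Fin 2) (Fin 2) k →ₗ[k] (Fin 3 → k) :=
    { toFun := fun T => ![-T 1 1, T 0 1, T 1 0]
      map_add' := fun T U => by
        ext i; fin_cases i <;> simp [add_comm]
      map_smul' := fun c T => by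
        ext i; fin_cases i <;> simp }
  have hπ₀ : ∀ T, π₀ T = ![-T 1 1, T 0 1, T 1 0] := fun _ => rfl
  -- `π₀ ∘ φ = id`, and `φ ∘ π₀ = id` on trace-zero matrices
  have hπφ : ∀ v, π₀ (φ v) = v := fun v => by
    rw [hφ, hπ₀]
    ext i; fin_cases i <;> simp
  have hφπ : ∀ T : Matrix (Fin 2) (Fin 2) k, T.trace = 0 → φ (π₀ T) = T := fun T hT => by
    rw [Matrix.trace_fin_two] at hT
    rw [hφ, hπ₀]
    ext i j; fin_cases i <;> fin_cases j
    · simp only [Fin.zero_eta, Fin.isValue, Matrix.of_apply, Matrix.cons_val', Matrix.cons_val_zero,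
        Matrix.cons_val_fin_one]
      linear_combination -hT
    · simp
    · simp
    · simp
  have hφtr : ∀ v, (φ v).trace = 0 := fun v => by
    rw [hφ, Matrix.trace_fin_two]; simp
  have hφinj : Function.Injective φ := fun v w hvw => by
    rw [← hπφ v, ← hπφ w, hvw]
  -- conjugation by `ρ g` on `𝔤𝔩₂`
  let c : Γ → (Matrix (Fin 2) (Fin 2) k →ₗ[k] Matrix (Fin 2) (Fin 2) k) := fun g =>
    LinearMap.mulRight k (((ρ g)⁻¹ : GL (Fin 2) k) : Matrix (Fin 2) (Fin 2) k) ∘ₗ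
      LinearMap.mulLeft k ((ρ g : GL (Fin 2) k) : Matrix (Fin 2) (Fin 2) k)
  have hc : ∀ g T, c g T = (ρ g : Matrix (Fin 2) (Fin 2) k) * T * ((ρ g)⁻¹ : GL (Fin 2) k) :=
    fun g T => rfl
  have hctr : ∀ g T, (c g T).trace = T.trace := fun g T => by
    rw [hc]; exact Matrix.trace_units_conj _ _
  have hc_one : ∀ T, c 1 T = T := fun T => by
    rw [hc, map_one, inv_one, Units.val_one, Matrix.one_mul, Matrix.mul_one]
  have hc_mul : ∀ g h T, c (g * h) T = c g (c h T) := fun g h T => by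
    simp only [hc, map_mul, _root_.mul_inv_rev, Units.val_mul]
    simp only [Matrix.mul_assoc]
  let Ad : Representation k Γ (Fin 3 → k) :=
    { toFun := fun g => π₀ ∘ₗ c g ∘ₗ φ
      map_one' := by
        refine LinearMap.ext fun v => ?_
        simp only [LinearMap.coe_comp, Function.comp_apply, hc_one, hπφ, Module.End.one_apply]
      map_mul' := fun g h => by
        refine LinearMap.ext fun v => ?_
        simp only [LinearMap.coe_comp, Function.comp_apply, Module.End.mul_apply]
        rw [hφπ _ (by rw [hctr, hφtr]), hc_mul] }
  have hAd : ∀ g v, Ad g v = π₀ (c g (φ v)) := fun _ _ => rfl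
  refine ⟨Ad, φ, hφinj, hφtr, fun g v => ?_, fun g => ?_⟩
  · rw [hAd, hφπ _ (by rw [hctr, hφtr]), hc]
  · -- the character: the trace of `v ↦ π₀(P φ(v) P⁻¹)` on `k³`
    have hPP := gl_two_inv_mul_apply_zero_zero (ρ g)
    change LinearMap.trace k (Fin 3 → k) (Ad g) = _
    rw [LinearMap.trace_eq_matrix_trace k (Pi.basisFun k (Fin 3)), Matrix.trace, Fin.sum_univ_three]
    simp only [Matrix.diag_apply, LinearMap.toMatrix_apply, Pi.basisFun_repr, Pi.basisFun_apply, hAd, hc,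
      hφ, hπ₀]
    rw [Matrix.trace_fin_two, Matrix.trace_fin_two]
    simp only [Nat.succ_eq_add_one, Nat.reduceAdd, Fin.isValue, Pi.single_eq_same, ne_eq, one_ne_zero,
      not_false_eq_true, Pi.single_eq_of_ne, Fin.reduceEq, Matrix.mul_apply, of_apply, cons_val', cons_val_fin_one,
      Fin.sum_univ_two, cons_val_zero, cons_val_one, mul_one, mul_zero, add_zero, mul_neg, zero_add, neg_mul,
      neg_add_rev, neg_neg, zero_ne_one, neg_zero, zero_mul, cons_val]
    linear_combination -hPP

/-! ### Commuting trace-zero `2 × 2` matrices are proportional -/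

/-- Over a field with `2 ≠ 0`: if `A ≠ 0` and `B` are trace-zero `2 × 2` matrices with `AB = BA`,
then `B = t • A` for some scalar `t` (the centraliser of a non-scalar `2 × 2` matrix `A` is
`k·1 + k·A`, and its trace-zero part is the line `k·A`). [folklore] -/
theorem exists_smul_of_commute_of_trace_eq_zero (h2 : (2 : k) ≠ 0) {A B : Matrix (Fin 2) (Fin 2) k}
    (hA : A ≠ 0) (htrA : A.trace = 0) (htrB : B.trace = 0) (hAB : A * B = B * A) :
    ∃ t : k, B = t • A := by
  rw [Matrix.trace_fin_two] at htrA htrB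
  have hA11 : A 1 1 = -A 0 0 := by linear_combination htrA
  have hB11 : B 1 1 = -B 0 0 := by linear_combination htrB
  have e00 := congr_fun (congr_fun hAB 0) 0
  have e01 := congr_fun (congr_fun hAB 0) 1
  have e10 := congr_fun (congr_fun hAB 1) 0
  simp only [Matrix.mul_apply, Fin.sum_univ_two, hA11, hB11] at e00 e01 e10
  -- the three `2 × 2` minors of `((A₀₀, A₀₁, A₁₀), (B₀₀, B₀₁, B₁₀))` vanish
  have m1 : A 0 1 * B 1 0 = B 0 1 * A 1 0 := by linear_combination e00
  have m2 : A 0 0 * B 0 1 = B 0 0 * A 0 1 := by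
    have : (2 : k) * (A 0 0 * B 0 1 - B 0 0 * A 0 1) = 0 := by linear_combination e01
    have := (mul_eq_zero.mp this).resolve_left h2
    linear_combination this
  have m3 : A 0 0 * B 1 0 = B 0 0 * A 1 0 := by
    have : (2 : k) * (A 0 0 * B 1 0 - B 0 0 * A 1 0) = 0 := by linear_combination -e10
    have := (mul_eq_zero.mp this).resolve_left h2
    linear_combination this
  -- `B = t • A` entrywise, with `t` read off a non-zero coordinate of `A`
  have key : ∀ t : k, B 0 0 = t * A 0 0 → B 0 1 = t * A 0 1 → B 1 0 = t * A 1 0 → B = t • A := by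
    intro t h0 h1 h3
    ext i j; fin_cases i <;> fin_cases j
    · simpa using h0
    · simpa using h1
    · simpa using h3
    · simp only [Fin.mk_one, Fin.isValue, Matrix.smul_apply, smul_eq_mul, hA11, hB11, h0]; ring
  by_cases ha : A 0 0 = 0
  · by_cases hb : A 0 1 = 0
    · by_cases hc : A 1 0 = 0
      · exact absurd (Matrix.ext fun i j => by
          fin_cases i <;> fin_cases j <;> simp [hA11, ha, hb, hc]) hA
      · refine ⟨B 1 0 / A 1 0, key _ ?_ ?_ ?_⟩
        · have : B 0 0 * A 1 0 = 0 := by rw [← m3, ha, zero_mul]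
          rw [(mul_eq_zero.mp this).resolve_right hc, ha, mul_zero]
        · have : B 0 1 * A 1 0 = 0 := by rw [← m1, hb, zero_mul]
          rw [(mul_eq_zero.mp this).resolve_right hc, hb, mul_zero]
        · rw [div_mul_cancel₀ _ hc]
    · refine ⟨B 0 1 / A 0 1, key _ ?_ ?_ ?_⟩
      · have : B 0 0 * A 0 1 = 0 := by rw [← m2, ha, zero_mul]
        rw [(mul_eq_zero.mp this).resolve_right hb, ha, mul_zero]
      · rw [div_mul_cancel₀ _ hb]
      · rw [div_mul_eq_mul_div, eq_div_iff hb, mul_comm (B 1 0), ← m1, mul_comm]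
  · refine ⟨B 0 0 / A 0 0, key _ ?_ ?_ ?_⟩
    · rw [div_mul_cancel₀ _ ha]
    · rw [div_mul_eq_mul_div, eq_div_iff ha, mul_comm (B 0 1), ← m2, mul_comm]
    · rw [div_mul_eq_mul_div, eq_div_iff ha, mul_comm (B 1 0), ← m3, mul_comm]

/-! ### Eigen-matrices of the conjugation action -/

/-- If a non-zero matrix `T` is an eigen-matrix of every conjugation `T ↦ ρ(g) T ρ(g)⁻¹`, `g ∈ Γ`,
then the eigenvalues form a character `χ : Γ → kˣ` with `ρ(g) T ρ(g)⁻¹ = χ(g) T`. [folklore] -/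
theorem exists_character_of_eigenmatrix (ρ : Γ →* GL (Fin 2) k) {T : Matrix (Fin 2) (Fin 2) k}
    (hT : T ≠ 0) (h : ∀ g, ∃ c : k, (ρ g : Matrix (Fin 2) (Fin 2) k) * T * ((ρ g)⁻¹ : GL (Fin 2) k) = c • T) :
    ∃ χ : Γ →* kˣ, ∀ g, (ρ g : Matrix (Fin 2) (Fin 2) k) * T * ((ρ g)⁻¹ : GL (Fin 2) k) = (χ g : k) • T := by
  choose c hc using h
  -- `conj` is a multiplicative action: `conj 1 = id`, `conj (gh) = conj g ∘ conj h`
  have hone : (ρ 1 : Matrix (Fin 2) (Fin 2) k) * T * ((ρ 1)⁻¹ : GL (Fin 2) k) = T := by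
    rw [map_one, inv_one, Units.val_one, Matrix.one_mul, Matrix.mul_one]
  have hmul : ∀ g h, (ρ (g * h) : Matrix (Fin 2) (Fin 2) k) * T * ((ρ (g * h))⁻¹ : GL (Fin 2) k) =
      (ρ g : Matrix (Fin 2) (Fin 2) k) * ((ρ h : Matrix (Fin 2) (Fin 2) k) * T *
        ((ρ h)⁻¹ : GL (Fin 2) k)) * ((ρ g)⁻¹ : GL (Fin 2) k) := fun g h => by
    simp only [map_mul, _root_.mul_inv_rev, Units.val_mul, Matrix.mul_assoc]
  have hcne : ∀ g, c g ≠ 0 := fun g hg => by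
    have h1 : (ρ g : Matrix (Fin 2) (Fin 2) k) * T * ((ρ g)⁻¹ : GL (Fin 2) k) = 0 := by
      rw [hc g, hg, zero_smul]
    apply hT
    calc T = ((ρ g)⁻¹ : GL (Fin 2) k) * ((ρ g : Matrix (Fin 2) (Fin 2) k) * T *
          ((ρ g)⁻¹ : GL (Fin 2) k)) * (ρ g : Matrix (Fin 2) (Fin 2) k) := by
            simp only [← Matrix.mul_assoc, Units.inv_mul, Matrix.one_mul]
            rw [Matrix.mul_assoc, Units.inv_mul, Matrix.mul_one]
      _ = 0 := by rw [h1, Matrix.mul_zero, Matrix.zero_mul]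
  have hcmul : ∀ g h, c (g * h) = c g * c h := fun g h => by
    apply smul_left_injective k hT
    change c (g * h) • T = (c g * c h) • T
    rw [← hc, hmul, hc h, Matrix.mul_smul, Matrix.smul_mul, hc g, smul_smul, mul_comm]
  have hcone : c 1 = 1 := by
    apply smul_left_injective k hT
    change c 1 • T = (1 : k) • T
    rw [← hc, hone, one_smul]
  exact ⟨{ toFun := fun g => Units.mk0 (c g) (hcne g)
           map_one' := Units.ext hcone
           map_mul' := fun g h => Units.ext (hcmul g h) }, fun g => hc g⟩

/-- **A reducible `Ad⁰` has an eigen-line.**  Let `ρ : Γ → GL₂(k)` (`2 ≠ 0` in `k`) and let `Ad` be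
a representation of `Γ` on a `3`-dimensional space `V` identified with the trace-zero matrices by
an injective linear `φ : V → M₂(k)` intertwining `Ad` with conjugation,
`φ(Ad(g) v) = ρ(g) φ(v) ρ(g)⁻¹`.  If `Ad` is NOT irreducible then some non-zero trace-zero matrix
`T` spans a `Γ`-stable line: `ρ(g) T ρ(g)⁻¹ = χ(g) T` for a character `χ : Γ → kˣ`.
(A stable subspace `S` of `V` has dimension `1` — giving `T = φ(v)` — or `2`, and then the
commutator `T = [φ(v), φ(w)]` of a basis is non-zero, because commuting trace-zero matrices are
proportional, and transforms by `det (Ad(g)|_S)`.) [folklore] -/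
theorem exists_eigenmatrix_of_not_isIrreducible (h2 : (2 : k) ≠ 0) (ρ : Γ →* GL (Fin 2) k)
    {V : Type*} [AddCommGroup V] [Module k V] [FiniteDimensional k V]
    (hV : Module.finrank k V = 3) (Ad : Representation k Γ V)
    (φ : V →ₗ[k] Matrix (Fin 2) (Fin 2) k) (hφ : Function.Injective φ)
    (hφtr : ∀ v, (φ v).trace = 0)
    (hAd : ∀ g v, φ (Ad g v) = (ρ g : Matrix (Fin 2) (Fin 2) k) * φ v * ((ρ g)⁻¹ : GL (Fin 2) k))
    (hirr : ¬ Ad.IsIrreducible) :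
    ∃ (T : Matrix (Fin 2) (Fin 2) k) (χ : Γ →* kˣ), T ≠ 0 ∧ T.trace = 0 ∧
      ∀ g, (ρ g : Matrix (Fin 2) (Fin 2) k) * T * ((ρ g)⁻¹ : GL (Fin 2) k) = (χ g : k) • T := by
  classical
  -- it suffices to find the eigen-matrix; the eigenvalues are then a character
  suffices h : ∃ T : Matrix (Fin 2) (Fin 2) k, T ≠ 0 ∧ T.trace = 0 ∧
      ∀ g, ∃ c : k, (ρ g : Matrix (Fin 2) (Fin 2) k) * T * ((ρ g)⁻¹ : GL (Fin 2) k) = c • T by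
    obtain ⟨T, hT, htr, hc⟩ := h
    obtain ⟨χ, hχ⟩ := exists_character_of_eigenmatrix ρ hT hc
    exact ⟨T, χ, hT, htr, hχ⟩
  -- a proper non-zero stable subspace `S`
  have hbot : (⊥ : Subrepresentation Ad).toSubmodule = ⊥ := rfl
  have htop : (⊤ : Subrepresentation Ad).toSubmodule = ⊤ := rfl
  haveI : Nontrivial V := Module.nontrivial_of_finrank_pos (R := k) (by rw [hV]; norm_num)
  have hbt : (⊥ : Subrepresentation Ad) ≠ ⊤ := by
    intro h
    have h' := congrArg Subrepresentation.toSubmodule h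
    rw [hbot, htop] at h'
    exact bot_ne_top h'
  obtain ⟨S, hS0, hS1⟩ : ∃ S : Subrepresentation Ad, S ≠ ⊥ ∧ S ≠ ⊤ := by
    by_contra hcon
    push Not at hcon
    haveI : Nontrivial (Subrepresentation Ad) := ⟨⟨⊥, ⊤, hbt⟩⟩
    exact hirr ⟨fun W ↦ or_iff_not_imp_left.mpr (hcon W)⟩
  have hS0' : S.toSubmodule ≠ ⊥ := fun h ↦ hS0 (Subrepresentation.toSubmodule_injective
    (by rw [h, hbot]))
  have hS1' : S.toSubmodule ≠ ⊤ := fun h ↦ hS1 (Subrepresentation.toSubmodule_injective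
    (by rw [h, htop]))
  -- `dim S ∈ {1, 2}`
  have hpos : 0 < Module.finrank k S.toSubmodule :=
    Nat.pos_of_ne_zero fun h ↦ hS0' (Submodule.finrank_eq_zero.mp h)
  have hlt : Module.finrank k S.toSubmodule < 3 := hV ▸ Submodule.finrank_lt hS1'
  have hconj_mul : ∀ (g : Γ) (A B : Matrix (Fin 2) (Fin 2) k),
      (ρ g : Matrix (Fin 2) (Fin 2) k) * (A * B) * ((ρ g)⁻¹ : GL (Fin 2) k) =
        ((ρ g : Matrix (Fin 2) (Fin 2) k) * A * ((ρ g)⁻¹ : GL (Fin 2) k)) *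
          ((ρ g : Matrix (Fin 2) (Fin 2) k) * B * ((ρ g)⁻¹ : GL (Fin 2) k)) := fun g A B => by
    simp only [Matrix.mul_assoc]
    rw [← Matrix.mul_assoc (((ρ g)⁻¹ : GL (Fin 2) k) : Matrix (Fin 2) (Fin 2) k), Units.inv_mul,
      Matrix.one_mul]
  rcases (show Module.finrank k S.toSubmodule = 1 ∨ Module.finrank k S.toSubmodule = 2 by omega)
    with h1 | h1
  · -- a stable line `k v`: `T = φ v`
    obtain ⟨v, hvS, hv0⟩ := Submodule.exists_mem_ne_zero_of_ne_bot hS0'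
    have hmult : ∀ u ∈ S.toSubmodule, ∃ c : k, c • v = u := by
      intro u hu
      obtain ⟨c, hc⟩ := (finrank_eq_one_iff_of_nonzero' (⟨v, hvS⟩ : S.toSubmodule)
        (by exact_mod_cast Subtype.coe_ne_coe.mp hv0 : (⟨v, hvS⟩ : S.toSubmodule) ≠ 0)).mp h1 ⟨u, hu⟩
      exact ⟨c, by simpa using congrArg Subtype.val hc⟩
    refine ⟨φ v, fun h ↦ hv0 (hφ (by rw [h, map_zero])), hφtr v, fun g ↦ ?_⟩
    obtain ⟨c, hc⟩ := hmult _ (S.apply_mem_toSubmodule g hvS)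
    exact ⟨c, by rw [← hAd, ← hc, map_smul]⟩
  · -- a stable plane with basis `v, w`: `T = [φ v, φ w]`
    let b := Module.finBasisOfFinrankEq k S.toSubmodule h1
    set v : V := ((b 0 : S.toSubmodule) : V) with hvdef
    set w : V := ((b 1 : S.toSubmodule) : V) with hwdef
    have hvS : v ∈ S.toSubmodule := (b 0).2
    have hwS : w ∈ S.toSubmodule := (b 1).2
    have hv0 : v ≠ 0 := fun h ↦ b.ne_zero 0 (Subtype.ext h)
    -- coordinates of elements of `S` in the basis
    have hcoord : ∀ u ∈ S.toSubmodule, ∃ α γ : k, u = α • v + γ • w := by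
      intro u hu
      refine ⟨b.repr ⟨u, hu⟩ 0, b.repr ⟨u, hu⟩ 1, ?_⟩
      have := congrArg Subtype.val (b.sum_repr ⟨u, hu⟩)
      simp only [Fin.sum_univ_two, Submodule.coe_add, Submodule.coe_smul] at this
      exact this.symm
    -- linear independence of `v, w` in `V`
    have hindep : ∀ t : k, w ≠ t • v := by
      intro t ht
      have hli := Fintype.linearIndependent_iff.mp b.linearIndependent ![-t, 1] (by
        rw [Fin.sum_univ_two]
        apply Subtype.ext
        simp only [Fin.isValue, Matrix.cons_val_zero, Matrix.cons_val_one, Matrix.cons_val_fin_one,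
          Submodule.coe_add, Submodule.coe_neg, Submodule.coe_smul, Submodule.coe_zero, neg_smul,
          one_smul]
        rw [← hvdef, ← hwdef, ht, neg_add_cancel]) 1
      simp at hli
    set T : Matrix (Fin 2) (Fin 2) k := φ v * φ w - φ w * φ v with hTdef
    have hT0 : T ≠ 0 := by
      intro hT
      have hcomm : φ v * φ w = φ w * φ v := sub_eq_zero.mp hT
      obtain ⟨t, ht⟩ := exists_smul_of_commute_of_trace_eq_zero h2
        (fun h ↦ hv0 (hφ (by rw [h, map_zero]))) (hφtr v) (hφtr w) hcomm
      exact hindep t (hφ (by rw [ht, map_smul]))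
    refine ⟨T, hT0, by rw [hTdef, Matrix.trace_sub, Matrix.trace_mul_comm, sub_self], fun g ↦ ?_⟩
    obtain ⟨α, γ, hgv⟩ := hcoord _ (S.apply_mem_toSubmodule g hvS)
    obtain ⟨β, δ, hgw⟩ := hcoord _ (S.apply_mem_toSubmodule g hwS)
    refine ⟨α * δ - β * γ, ?_⟩
    rw [hTdef, Matrix.mul_sub, Matrix.sub_mul, hconj_mul, hconj_mul, ← hAd, ← hAd, hgv, hgw, map_add,
      map_add, map_smul, map_smul, map_smul, map_smul]
    simp only [Matrix.mul_add, Matrix.add_mul, Matrix.smul_mul, Matrix.mul_smul, smul_sub]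
    module

end Summit.Langlands.Langlands.Theorems.EssSelfDualIrreducibleCM

end
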